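import Literature.AlgebraicGeometry.Motives.GrassmannianSchemeOpenCover
import Literature.AlgebraicGeometry.Motives.GrassmannianRepresentable
import Literature.AlgebraicGeometry.Motives.GrassmannianChartNatural
import Literature.AlgebraicGeometry.Motives.GrassmannianChartReflect
import Literature.AlgebraicGeometry.Motives.GrassmannianOneChartTransition
import HarnessLib

/-!
# The overlaps of the standard charts of the Grassmannian scheme

Topic `AlgebraicGeometry/Motives`; namespace `Literature.AlgebraicGeometry.Motives.Grassmannian`.  THEOREMS ONLY (no definition,
no instance, no notation, no named fact, no `sorry`).  Scheme-side input (F4-2a) of «`Gr(1, L)` is projective over `ℤ`» (cell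
hodgecm-mathlib, (h4) / Plücker sub-hand F4).  For a `ℤ`-basis `b : J → M` and the chart immersions
`(chartOpenCover k M b).f I : Spec ℤ[X_I] ⟶ grassmannianScheme M k` (★ `GrassmannianSchemeOpenCover`, `GrassmannianSchemeCharts`):

* §1 (any rank `k`) **`exists_comp_chartι_eq_iff`** — `t : T ⟶ Gr` factors through the chart immersion at `I` iff
  `range t ⊆ chartLocus (b ∘ I) x₀` (`x₀ = pointsEquiv (𝟙 Gr)` the universal element; ★ `map_mem_chartSubsheaf_iff`,
  `range_chartMap_app_eq`, `pointsEquiv_comp_symm_chartElem`); **`opensRange_chartι_eq`** — the image of the chart immersion IS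
  the chart locus of the universal element; `preimage_chartLocus` (naturality of `chartLocus`); **`preimage_opensRange_chartι`**
  — the overlap `U_I′ ∩ U_I` pulled back to the chart `Spec ℤ[X_{I′}]` is `chartLocus (b ∘ I) (chartElem I′)`.
* §2 (rank one) **`chartLocus_one_chartElem_eq_basicOpen`** and **`preimage_opensRange_chartι_one`** — for one-element frames
  `{j}`, `{l}`: inside the chart `Spec ℤ[X^{(j)}]`, the overlap `U_j ∩ U_l` is the basic open `D(c_{jl})` of the coordinate
  `c_{jl} := chartCoordMap (b l) 0` («`x_l / x_j`»; F4-1 `mem_chart_one_iff_isUnit_coordMap` at the residue fields).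

[Hartshorne1977, II Thm. 7.1 (proof: `X_i ∩ X_j = X_{s_j/s_i}`)]; [GortzWedhorn2020, (8.4) (pp. 213–215)]; [StacksProject, Tag 089T].
Cell `hodgecm-mathlib` (D-0151), count-neutral Mathlib-side capital; nothing here is about HC — HC_CM is proved only modulo the 7
printed citations until rung 0 closes.
-/

universe u

open CategoryTheory Opposite TensorProduct _root_.AlgebraicGeometry

namespace Literature.AlgebraicGeometry.Motives.Grassmannian

/-! ## §1 Factorisation through a chart immersion; the image of a chart -/

section AnyRank

variable (k : ℕ) (M : Type u) [AddCommGroup M] {J : Type u} (b : Module.Basis J ℤ M)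
  [(grassmannianSheaf M k).obj.IsRepresentable]

/-- **Factorisation through a chart immersion**: `t : T ⟶ Gr` factors through the chart immersion at `I` iff `t` lands in the
chart locus of the universal element `x₀ = pointsEquiv (𝟙 Gr)` for the frame `b ∘ I`.
[cite: GortzWedhorn2020, (8.4) (pp. 213–215)] [cite: StacksProject, Tag 089T] -/
theorem exists_comp_chartι_eq_iff (I : {I : Fin k → J // Function.Injective I}) {T : Scheme.{u}}
    (t : T ⟶ grassmannianScheme M k) :
    (∃ s : T ⟶ chartScheme k I.1, s ≫ (chartOpenCover k M b).f I = t) ↔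
      Set.range t ⊆ (chartLocus (⇑b ∘ I.1) (pointsEquiv M k _ (𝟙 (grassmannianScheme M k))) : Set _) := by
  have hx : (grassmannianSheaf M k).obj.map t.op (pointsEquiv M k _ (𝟙 (grassmannianScheme M k))) = pointsEquiv M k T t := by
    rw [← pointsEquiv_comp, Category.comp_id]
  rw [← map_mem_chartSubsheaf_iff, hx, ← range_chartMap_app_eq k M b I.1 I.2 T, Set.mem_range, chartOpenCover_f]
  constructor
  · rintro ⟨s, hs⟩
    exact ⟨s, by rw [← pointsEquiv_comp_symm_chartElem, hs]⟩
  · rintro ⟨s, hs⟩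
    exact ⟨s, (pointsEquiv M k T).injective (by rw [pointsEquiv_comp_symm_chartElem, hs])⟩

/-- **The image of a chart immersion is the chart locus of the universal element.**
[cite: GortzWedhorn2020, (8.4) (pp. 213–215)] [cite: StacksProject, Tag 089T] -/
theorem opensRange_chartι_eq (I : {I : Fin k → J // Function.Injective I}) :
    ((chartOpenCover k M b).f I).opensRange =
      chartLocus (⇑b ∘ I.1) (pointsEquiv M k _ (𝟙 (grassmannianScheme M k))) := by
  ext y
  constructor
  · rintro ⟨z, rfl⟩
    exact (exists_comp_chartι_eq_iff k M b I ((chartOpenCover k M b).f I)).1 ⟨𝟙 _, Category.id_comp _⟩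
      (Set.mem_range_self z)
  · intro hy
    have hsub : Set.range ((grassmannianScheme M k).fromSpecResidueField y) ⊆
        (chartLocus (⇑b ∘ I.1) (pointsEquiv M k _ (𝟙 (grassmannianScheme M k))) : Set _) := by
      rw [Scheme.range_fromSpecResidueField, Set.singleton_subset_iff]
      exact hy
    obtain ⟨s, hs⟩ := (exists_comp_chartι_eq_iff k M b I _).2 hsub
    have hy' : y ∈ Set.range ((grassmannianScheme M k).fromSpecResidueField y) := by
      rw [Scheme.range_fromSpecResidueField]; exact Set.mem_singleton y
    obtain ⟨p, hp⟩ := hy'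
    refine ⟨s p, ?_⟩
    have h' : (s ≫ (chartOpenCover k M b).f I) p = y := by rw [hs]; exact hp
    exact h'

omit [(grassmannianSheaf M k).obj.IsRepresentable] in
/-- **Naturality of the chart locus**: `h⁻¹ (chartLocus x y) = chartLocus x (h^* y)` (point values are natural and chart membership is
invariant under extension of the residue field). [cite: GortzWedhorn2020, (8.4), Lemma 8.13 (p. 215)] -/
theorem preimage_chartLocus (x : Fin k → M) {T T' : Scheme.{u}} (h : T' ⟶ T) (y : (grassmannianSheaf M k).obj.obj (op T)) :
    h ⁻¹ᵁ chartLocus x y = chartLocus x ((grassmannianSheaf M k).obj.map h.op y) := by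
  ext t'
  change h t' ∈ chartLocus x y ↔ t' ∈ chartLocus x _
  rw [mem_chartLocus_iff, mem_chartLocus_iff, ptEval_map,
    map_mem_chart_iff_of_field (R := ℤ) (M := M) ((h.residueFieldMap t').hom.toIntAlgHom)]

/-- **The overlap of two charts, pulled back to the first chart**: `ι_{I′}⁻¹ (U_I) = chartLocus (b ∘ I) (chartElem I′)` inside
`Spec ℤ[X_{I′}]`. [cite: GortzWedhorn2020, (8.4) (pp. 213–215)] [cite: StacksProject, Tag 089T] -/
theorem preimage_opensRange_chartι (I I' : {I : Fin k → J // Function.Injective I}) :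
    (chartOpenCover k M b).f I' ⁻¹ᵁ ((chartOpenCover k M b).f I).opensRange =
      chartLocus (⇑b ∘ I.1) (chartElem k M b I'.1 I'.2) := by
  rw [opensRange_chartι_eq, preimage_chartLocus]
  congr 1
  rw [← pointsEquiv_comp, Category.comp_id]
  exact Equiv.apply_symm_apply _ _

end AnyRank

/-! ## §2 Rank one: the overlap is the basic open of the transition coordinate -/

section RankOne

variable (M : Type u) [AddCommGroup M] {J : Type u} (b : Module.Basis J ℤ M)

/-- A one-element frame `Fin 1 → J` is injective. [folklore] -/
private theorem injective_const_fin_one (j : J) : Function.Injective (fun _ : Fin 1 => j) :=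
  Function.injective_of_subsingleton _

/-- **In rank one, the chart locus of the universal chart point `chartElem {j}` for the frame `{l}` is the basic open
`D(c_{jl}) ⊆ Spec ℤ[X^{(j)}]`** of the coordinate `c_{jl} = chartCoordMap (b l) 0` («`x_l/x_j`»): at a point `q`, the residue-field
value of the universal point lies in the chart `{l}` iff `c_{jl}` is a unit in `κ(q)` (F4-1 `mem_chart_one_iff_isUnit_coordMap`).
[cite: Hartshorne1977, II Thm. 7.1] [cite: StacksProject, Tag 089T] -/
theorem chartLocus_one_chartElem_eq_basicOpen (j l : J) :
    chartLocus (⇑b ∘ fun _ : Fin 1 => l) (chartElem 1 M b (fun _ => j) (injective_const_fin_one j)) =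
      PrimeSpectrum.basicOpen (chartCoordMap 1 M b (fun _ => j) (b l) 0) := by
  ext q
  change q ∈ chartLocus _ _ ↔ q ∈ PrimeSpectrum.basicOpen _
  rw [mem_chartLocus_iff_of_isAffine, evalAffine_top, specEquiv_chartElem, ← Module.Grassmannian.map_comp]
  -- the universal point is the chart point of `chartCoordMap`; push it along the composite ring map to `κ(q)`
  set φ : (chartRing 1 fun _ : Fin 1 => j) →ₐ[ℤ] (chartScheme 1 fun _ : Fin 1 => j).residueField q :=
    ((chartScheme 1 fun _ : Fin 1 => j).Γevaluation q).hom.toIntAlgHom.comp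
      (Scheme.ΓSpecIso (chartRing 1 fun _ : Fin 1 => j)).inv.hom.toIntAlgHom with hφ
  have hmem := chartElemAffine_mem_chart 1 M b (fun _ : Fin 1 => j) (injective_const_fin_one j)
  rw [mem_chart_one_iff_isUnit_coordMap (⇑b ∘ fun _ : Fin 1 => j) (⇑b ∘ fun _ : Fin 1 => l) _ (map_mem_chart φ hmem),
    coordMap_map φ _ _ hmem]
  have hc : coordMap (⇑b ∘ fun _ : Fin 1 => j) (chartElemAffine 1 M b (fun _ => j) (injective_const_fin_one j)) hmem =
      chartCoordMap 1 M b (fun _ => j) :=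
    coordMap_ofCoordMap _ _ _
  rw [hc]
  change IsUnit ((chartScheme 1 fun _ : Fin 1 => j).Γevaluation q
    ((Scheme.ΓSpecIso (chartRing 1 fun _ : Fin 1 => j)).inv (chartCoordMap 1 M b (fun _ => j) (b l) 0))) ↔ _
  rw [isUnit_iff_ne_zero, Scheme.evaluation_ne_zero_iff_mem_basicOpen, ← basicOpen_eq_of_affine]
  rfl

variable [(grassmannianSheaf M 1).obj.IsRepresentable]

/-- **In rank one, the overlap `U_j ∩ U_l` pulled back to the chart `Spec ℤ[X^{(j)}]` is the basic open `D(c_{jl})`.**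
[cite: Hartshorne1977, II Thm. 7.1] [cite: StacksProject, Tag 089T] -/
theorem preimage_opensRange_chartι_one (j l : J) :
    (chartOpenCover 1 M b).f ⟨fun _ => j, injective_const_fin_one j⟩ ⁻¹ᵁ
        ((chartOpenCover 1 M b).f ⟨fun _ => l, injective_const_fin_one l⟩).opensRange =
      PrimeSpectrum.basicOpen (chartCoordMap 1 M b (fun _ => j) (b l) 0) := by
  rw [preimage_opensRange_chartι]
  exact chartLocus_one_chartElem_eq_basicOpen M b j l

end RankOne

end Literature.AlgebraicGeometry.Motives.Grassmannian
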